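import Literature.IUT.LogVolume.PadicSubfields
import Literature.AnabelianGeometry.AbsoluteAnabelian.LogShellsOfUnitLog
import Summits.ABC.IUTFork.LanaLogLinkFrobenius
import Summits.ABC.IUTFork.LanaLogShellHF
import HarnessLib

/-!
# L-LANA objects VI ter: `O_v ⊂ I_v` for the printed log-shell at the `ℚ_p` datum (LANA §5.1 p. 26, proof-only)

Proof-only companion (D-0012; seat abc-iut-c312-4, L-LANA level, plan/LLANA-SPEC N10) of
`LanaLogLinkFrobenius.lean` (`printedLogShell p` = LANA's `I_v := (2p_v)⁻¹ · Im(O^×_v ↪ O^×_{K̄_v} ↠ O^{×μ}_v →^{log}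
K̄_v) ⊂ K̄_v` at the `ℚ_p` datum, with the REAL logarithm of layer L4); TAKES NO SIDE on [IUTchIII] Cor. 3.12.
LANA §5.1 p. 26, the sentence right after the display: "note that the factor `(2p_v)⁻¹` makes the inclusion
`O_v ⊂ I_v` to hold." THIS file proves it at the `ℚ_p` datum:

* **`algebraMap_mem_printedLogShell`** — every `x ∈ ℤ_p` (i.e. `x ∈ ℚ_p`, `‖x‖ ≤ 1`) lies in `I_v ⊂ ℚ̄_p`.

Route (no new analysis): abc-iut-S1/L3-t11's `closedBall_subset_smul_logUnits` ("`𝒪_k ⊆ (p*)⁻¹ · log_p(𝒪_k^×)`",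
`p* = p` for odd `p`, `4` for `p = 2`; [AbsTopIII] Def. 5.4 (iii)) applied to the finite subfield `ℚ_p = ⊥ ⊆ ℚ̄_p`,
abc-iut-S1's compatibility `coe_unitLog_eq_padicLogAlgCl` of the two real logarithms, invariance of `ℚ_p`-rational
units under `G_{ℚ_p}`, and gen 2's arithmetic `2p = p* · (1 or 2)` (`two_mul_eq_pstarNat_mul`): if `p*·x = log u` then
`2p·x = log(u^{2p/p*})`. [cite: LANA2026Report, §5.1 p. 26] [cite: MochizukiAbsTopIII2015, Def 5.4 (iii) p. 126]
NOT here: any judgement.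
-/

noncomputable section

namespace Summit.ABC
namespace IUTFork

open Literature.AnabelianGeometry.AbsoluteAnabelian Literature.IUT.LogVolume
open Literature.NumberTheory.Transcendental (padicLogAlgCl)
open scoped NNReal Pointwise

variable (p : ℕ) [Fact p.Prime]

/-- An element of the bottom intermediate field `ℚ_p ⊆ ℚ̄_p` is fixed by `G_{ℚ_p}`. [folklore] -/
theorem smul_eq_self_of_mem_bot {u : PadicAlgCl p} (hu : u ∈ (⊥ : IntermediateField ℚ_[p] (PadicAlgCl p)))
    (σ : PadicGal p) : σ • u = u := by
  obtain ⟨y, rfl⟩ := IntermediateField.mem_bot.mp hu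
  rw [AlgEquiv.smul_def, AlgEquiv.commutes]

/-- A `G_{ℚ_p}`-fixed valuation-one unit of `ℚ̄_p` lies in `O^×_v = (O^×_{ℚ̄_p})^{G_{ℚ_p}}` (LANA §3.9 "`O^×_v :=
(O^×_{K̄_v})^{G_v}`"). [cite: LANA2026Report, §3.9 p. 21] -/
theorem mem_unitInv_of_forall_smul (U : unitGrp (padicVal p))
    (hU : ∀ σ : PadicGal p, σ • ((U : (PadicAlgCl p)ˣ) : PadicAlgCl p) = ((U : (PadicAlgCl p)ˣ) : PadicAlgCl p)) :
    U ∈ unitInv (padicVal p) (PadicGal p) := by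
  rw [unitInv, mem_unitInvariants_iff]
  intro σ
  exact Subtype.ext (Units.ext (by rw [unitGrp.coe_smul]; exact hU σ))

/-- `log` of a power of a unit: `log(U^n) = n · log U` (from the homomorphism `padicLogUnits`).
[cite: LANA2026Report, §5.1 p. 26] -/
theorem padicLogAlgCl_unitGrp_pow (U : unitGrp (padicVal p)) (n : ℕ) :
    padicLogAlgCl p (((U ^ n : unitGrp (padicVal p)) : (PadicAlgCl p)ˣ) : PadicAlgCl p) =
      (n : PadicAlgCl p) * padicLogAlgCl p ((U : (PadicAlgCl p)ˣ) : PadicAlgCl p) := by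
  have h := congrArg Multiplicative.toAdd (map_pow (padicLogUnits p) U n)
  rw [padicLogUnits_apply, padicLogUnits_apply, toAdd_ofAdd, toAdd_pow, toAdd_ofAdd, nsmul_eq_mul] at h
  exact h

/-- **LANA p. 26: "the factor `(2p_v)⁻¹` makes the inclusion `O_v ⊂ I_v` to hold" — PROVED at the `ℚ_p` datum**:
every `p`-adic integer `x ∈ ℤ_p ⊂ ℚ̄_p` lies in the printed log-shell `I_v = (2p)⁻¹ · log((O^×_{ℚ̄_p})^{G_{ℚ_p}})`.
(From `ℤ_p ⊆ (p*)⁻¹ · log_p(ℤ_p^×)`, [AbsTopIII] Def. 5.4 (iii) for the real logarithm, and `2p ∈ p* · ℕ`.)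
[cite: LANA2026Report, §5.1 p. 26] [cite: MochizukiAbsTopIII2015, Def 5.4 (iii) p. 126] -/
theorem algebraMap_mem_printedLogShell (x : ℚ_[p]) (hx : ‖x‖ ≤ 1) :
    algebraMap ℚ_[p] (PadicAlgCl p) x ∈ printedLogShell p := by
  -- work in the finite subfield `E = ℚ_p = ⊥ ⊆ ℚ̄_p`
  let E : IntermediateField ℚ_[p] (PadicAlgCl p) := ⊥
  let xE : E := ⟨algebraMap ℚ_[p] (PadicAlgCl p) x, IntermediateField.mem_bot.mpr ⟨x, rfl⟩⟩
  have hxE : xE ∈ Metric.closedBall (0 : E) 1 := by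
    rw [Metric.mem_closedBall, dist_zero_right]
    change ‖algebraMap ℚ_[p] (PadicAlgCl p) x‖ ≤ 1
    rwa [PadicAlgCl.norm_extends]
  -- `xE ∈ (p*)⁻¹ · log_p(𝒪_E^×)`
  obtain ⟨z, hz, hxz⟩ := Set.mem_smul_set.mp (closedBall_subset_smul_logUnits p E hxE)
  obtain ⟨u, hu1, huz⟩ := mem_logUnits_iff.mp hz
  -- so `p* · x = log u` in `ℚ̄_p`, with `u ∈ E` a unit of norm `1`
  set ps : ℕ := p ^ (if p = 2 then 2 else 1) with hps
  have hps0 : ((ps : ℕ) : E) ≠ 0 := pstarNat_cast_ne_zero p E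
  have hpx : ((ps : ℕ) : PadicAlgCl p) * algebraMap ℚ_[p] (PadicAlgCl p) x = padicLogAlgCl p (u : PadicAlgCl p) := by
    have h1 : ((ps : ℕ) : E) * xE = unitLog u := by
      rw [← hxz, huz, smul_eq_mul, ← mul_assoc, mul_inv_cancel₀ hps0, one_mul]
    have h2 := congrArg (fun e : E => (e : PadicAlgCl p)) h1
    simpa [coe_unitLog_eq_padicLogAlgCl p E hu1] using h2
  -- the invariant unit `U := u ∈ O^×_v` and its power `U^{2p/p*}`
  have hu1' : ‖(u : PadicAlgCl p)‖ = 1 := hu1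
  let U : unitGrp (padicVal p) := ⟨_, mem_unitGrp_of_norm_eq_one p hu1'⟩
  have hUval : ((U : (PadicAlgCl p)ˣ) : PadicAlgCl p) = (u : PadicAlgCl p) := rfl
  have hUinv : U ∈ unitInv (padicVal p) (PadicGal p) :=
    mem_unitInv_of_forall_smul p U fun σ => by rw [hUval]; exact smul_eq_self_of_mem_bot p u.2 σ
  let n : ℕ := if p = 2 then 1 else 2
  refine ⟨U ^ n, Subgroup.pow_mem _ hUinv n, ?_⟩
  rw [padicLogAlgCl_unitGrp_pow, hUval, ← hpx, ← mul_assoc]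
  congr 1
  have h2p : 2 * p = ps * n := two_mul_eq_pstarNat_mul p
  rw [h2p, Nat.cast_mul]
  exact mul_comm _ _

/-- The same for an element of `ℚ̄_p` known to lie in `ℚ_p` with norm `≤ 1`. [cite: LANA2026Report, §5.1 p. 26] -/
theorem mem_printedLogShell_of_mem_bot {y : PadicAlgCl p} (hy : y ∈ (⊥ : IntermediateField ℚ_[p] (PadicAlgCl p)))
    (hy1 : ‖y‖ ≤ 1) : y ∈ printedLogShell p := by
  obtain ⟨x, rfl⟩ := IntermediateField.mem_bot.mp hy
  refine algebraMap_mem_printedLogShell p x ?_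
  rwa [PadicAlgCl.norm_extends] at hy1

/-- In particular `1 ∈ I_v` (the printed log-shell contains the unit of the field structure it sits in).
[cite: LANA2026Report, §5.1 p. 26] -/
theorem one_mem_printedLogShell : (1 : PadicAlgCl p) ∈ printedLogShell p := by
  have h := algebraMap_mem_printedLogShell p 1 (by rw [norm_one])
  rwa [map_one] at h

end IUTFork

end Summit.ABC

end
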